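import Mathlib
import Literature.NumberTheory.LFunctions.Zhang2022.Section14Prop141Discharge
import Literature.NumberTheory.LFunctions.Zhang2022.Section14GaussSums
import HarnessLib

/-!
# Zhang (2022) §14: summability of the `l`-series and the characters to the modulus `Dk` (D15 / C36)

Topic `Literature/NumberTheory/LFunctions/Zhang2022` (Landau–Siegel audit tree; verdict-neutral).
Y. Zhang, *Discrete mean estimates and the Landau–Siegel zero*, arXiv:2211.02515v1 (2022)
[Zhang2022LandauSiegel] — **an unrefereed manuscript under adjudication**; nothing here asserts its
claims. Technical inputs for the kernel proof of the deduction node of (14.5)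
(`Section14Eq145Discharge.dedEq145_holds`), all about the typed §14 objects of `TypedSection14.lean`:

* `summable_kappa_mul_DeltaW` — under (14.1) (`|κ*(m)| ≤ Bτ₅(m) ≤ Bm⁵`, `zeta_pow_apply_le`) and for
  `D ≥ 3`, every series `Σ_l κ*(dl)g(l)Δ(l/Q)` with bounded `g` converges absolutely, because
  `|Δ(l/Q)| ≪ l⁻⁸` (`exists_norm_DeltaW_div_le`, from the tree's super-polynomial decay of `Δ`,
  `Lemma53.exists_norm_Delta510_le_rpow_neg`, and the trivial bound `norm_Delta510_le`). This is the
  (unprinted) justification for exchanging `Σ_{p∼P}` with `Σ_l` between (14.7) and (14.8).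
* `sum_characters_split` — `Σ_{θ mod N} = [θ = ψ⁰] + [θ = θ₁] + Σ_{θ ≠ ψ⁰, θ₁}`;
  `thetaOne_ne_one`, `thetaOne_inv` (`θ_k¹` is non-principal and real), `apply_neg_natCast_eq_zero`,
  `chi_sq_of_mem_primeWindow` (`χ(p)² = 1`, with `p > D` from `Section14GaussSums.lt_of_mem_primeWindow`),
  `card_primeWindow_le` (`≤ 3P` members), `major1413_nonneg`, `eventually_log_rpow_le_rpow_quarter`.

## References

* Y. Zhang, arXiv:2211.02515v1 (2022), §14 pp. 76–79, (14.1), (14.7)–(14.8), u013–u015; §5 Lemma 5.3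
  p. 25; §2 p. 4. [cite: Zhang2022LandauSiegel, §14 (14.7)–(14.8) pp.78–79]
-/

noncomputable section

open Complex Real ComplexConjugate

namespace Literature.NumberTheory.LFunctions.Zhang2022.Typed.Sec14

open Skeleton Filter

/-! ### Summability of the `l`-series of §14 (needed to exchange `Σ_{p∼P}` with `Σ_l`) -/

section Summability

/-- `τ_k(n) ≤ n^k`: a crude polynomial bound for the `k`-fold divisor function `ζ^{∗k}`. [folklore] -/
private theorem zeta_pow_apply_le (k n : ℕ) :
    (ArithmeticFunction.zeta ^ k : ArithmeticFunction ℕ) n ≤ n ^ k := by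
  induction k generalizing n with
  | zero =>
      rw [pow_zero, pow_zero, ArithmeticFunction.one_apply]
      split_ifs <;> simp
  | succ k ih =>
      rw [pow_succ, ArithmeticFunction.mul_zeta_apply]
      calc ∑ i ∈ n.divisors, (ArithmeticFunction.zeta ^ k : ArithmeticFunction ℕ) i
          ≤ ∑ i ∈ n.divisors, n ^ k := by
            refine Finset.sum_le_sum fun i hi => (ih i).trans ?_
            exact Nat.pow_le_pow_left (Nat.divisor_le hi) k
        _ = n.divisors.card * n ^ k := by rw [Finset.sum_const, smul_eq_mul]
        _ ≤ n * n ^ k := Nat.mul_le_mul_right _ (Nat.card_divisors_le_self n)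
        _ = n ^ (k + 1) := by ring

/-- Under (14.1), `|κ*(m)| ≤ B m⁵`. [cite: Zhang2022LandauSiegel, §14 (14.1) p.76] -/
theorem norm_le_of_eq141 {B : ℝ} {κs : ℕ → ℂ} (hκ : Eq141 B κs) (m : ℕ) :
    ‖κs m‖ ≤ |B| * (m : ℝ) ^ 5 := by
  have h1 := hκ m
  have h2 : (((ArithmeticFunction.zeta ^ 5 : ArithmeticFunction ℕ) m : ℕ) : ℝ) ≤ (m : ℝ) ^ 5 := by
    exact_mod_cast zeta_pow_apply_le 5 m
  have h0 : (0 : ℝ) ≤ ((ArithmeticFunction.zeta ^ 5 : ArithmeticFunction ℕ) m : ℕ) := Nat.cast_nonneg _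
  calc ‖κs m‖ ≤ B * ((ArithmeticFunction.zeta ^ 5 : ArithmeticFunction ℕ) m : ℝ) := h1
    _ ≤ |B| * ((ArithmeticFunction.zeta ^ 5 : ArithmeticFunction ℕ) m : ℝ) := by
        gcongr; exact le_abs_self B
    _ ≤ |B| * (m : ℝ) ^ 5 := by gcongr

/-- **Polynomial decay of `Δ(l/Q)` in `l`**: for `D ≥ 3` (so that `𝓛₂ = 𝓛⁴⁰⁰ ≥ 1`) and `Q > 0` there
is `C` with `|Δ(l/Q)| ≤ C l^{−8}` for all `l ≥ 1` (the tree's super-polynomial decay of `Δ`,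
`Lemma53.exists_norm_Delta510_le_rpow_neg`, with the trivial bound `norm_Delta510_le` below `x = 1`).
[cite: Zhang2022LandauSiegel, §5 Lemma 5.3 p.25] -/
theorem exists_norm_DeltaW_div_le {D : ℕ} (hD : 3 ≤ D) {Q : ℝ} (hQ : 0 < Q) :
    ∃ C : ℝ, 0 ≤ C ∧ ∀ l : ℕ, 1 ≤ l → ‖DeltaW D ((l : ℝ) / Q)‖ ≤ C * (l : ℝ) ^ (-(8 : ℝ)) := by
  have h3 : (3 : ℝ) ≤ D := by exact_mod_cast hD
  have hlog : 1 ≤ Real.log D := by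
    rw [← Real.log_exp 1]
    refine Real.log_le_log (Real.exp_pos 1) (le_trans ?_ h3)
    have := Real.exp_one_lt_d9; linarith
  have hL2 : 1 ≤ ell2 D := by
    rw [ell2, ell]; exact one_le_pow₀ hlog
  have hL2pos : 0 < ell2 D := by linarith
  obtain ⟨C₈, hC₈0, hC₈⟩ := Lemma53.exists_norm_Delta510_le_rpow_neg hL2 (t0 D) 8
  set M : ℝ := Real.exp (1 / (16 * ell2 D ^ 2)) * (Real.sqrt π / ell2 D) with hM
  have hM0 : 0 ≤ M := by positivity
  refine ⟨(C₈ + M) * Q ^ (8 : ℝ), by positivity, fun l hl => ?_⟩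
  have hl0 : (0 : ℝ) < l := by exact_mod_cast hl
  have hx0 : 0 < (l : ℝ) / Q := div_pos hl0 hQ
  rw [DeltaW, Lemma53.Delta57_eq_Delta510 hL2pos (t0 D) hx0]
  have hQl : Q ^ (8 : ℝ) * (l : ℝ) ^ (-(8 : ℝ)) = ((l : ℝ) / Q) ^ (-(8 : ℝ)) := by
    rw [Real.div_rpow hl0.le hQ.le, Real.rpow_neg hl0.le, Real.rpow_neg hQ.le]
    field_simp
  rcases le_or_gt 1 ((l : ℝ) / Q) with hx1 | hx1
  · calc ‖Lemma53.Delta510 (ell2 D) (t0 D) ((l : ℝ) / Q)‖ ≤ C₈ * ((l : ℝ) / Q) ^ (-(8 : ℕ) : ℝ) :=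
          hC₈ _ hx1
      _ ≤ (C₈ + M) * ((l : ℝ) / Q) ^ (-(8 : ℝ)) := by
          norm_num
          gcongr; linarith
      _ = (C₈ + M) * Q ^ (8 : ℝ) * (l : ℝ) ^ (-(8 : ℝ)) := by rw [mul_assoc, hQl]
  · -- `x < 1`: the trivial bound, and `x^{-8} ≥ 1`
    have hx8 : 1 ≤ ((l : ℝ) / Q) ^ (-(8 : ℝ)) := by
      rw [Real.rpow_neg hx0.le]
      exact one_le_inv_iff₀.mpr ⟨Real.rpow_pos_of_pos hx0 _,
        Real.rpow_le_one hx0.le hx1.le (by norm_num)⟩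
    calc ‖Lemma53.Delta510 (ell2 D) (t0 D) ((l : ℝ) / Q)‖ ≤ M := Lemma53.norm_Delta510_le hL2pos _ _
      _ ≤ (C₈ + M) * ((l : ℝ) / Q) ^ (-(8 : ℝ)) := by nlinarith
      _ = (C₈ + M) * Q ^ (8 : ℝ) * (l : ℝ) ^ (-(8 : ℝ)) := by rw [mul_assoc, hQl]

/-- **Summability of the `l`-series of §14**: under (14.1), for `D ≥ 3`, `Q > 0` and any bounded
weight `g`, `Σ_l κ*(dl)g(l)Δ(l/Q)` converges absolutely (`|κ*(dl)| ≤ B(dl)⁵`, `|Δ(l/Q)| ≪ l⁻⁸`).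
[cite: Zhang2022LandauSiegel, §14 (14.4) p.77] -/
theorem summable_kappa_mul_DeltaW {D : ℕ} (hD : 3 ≤ D) {B : ℝ} {κs : ℕ → ℂ} (hκ : Eq141 B κs)
    (d : ℕ) {Q : ℝ} (hQ : 0 < Q) {g : ℕ → ℂ} {G : ℝ} (hg : ∀ l, ‖g l‖ ≤ G) :
    Summable fun l : ℕ => κs (d * l) * g l * DeltaW D ((l : ℝ) / Q) := by
  obtain ⟨C, hC0, hC⟩ := exists_norm_DeltaW_div_le hD hQ
  have hG : 0 ≤ G := le_trans (norm_nonneg _) (hg 0)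
  set K : ℝ := |B| * (d : ℝ) ^ 5 * G * C with hK
  refine Summable.of_norm_bounded_eventually_nat
    (g := fun l : ℕ => K * (l : ℝ) ^ (-(3 : ℝ))) ?_ ?_
  · exact (Real.summable_nat_rpow.mpr (by norm_num)).mul_left K
  · filter_upwards [Filter.eventually_ge_atTop 1] with l hl
    have hl0 : (0 : ℝ) < l := by exact_mod_cast hl
    have h1 := norm_le_of_eq141 hκ (d * l)
    have h2 := hg l
    have h3 := hC l hl
    calc ‖κs (d * l) * g l * DeltaW D ((l : ℝ) / Q)‖
        = ‖κs (d * l)‖ * ‖g l‖ * ‖DeltaW D ((l : ℝ) / Q)‖ := by rw [norm_mul, norm_mul]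
      _ ≤ (|B| * ((d * l : ℕ) : ℝ) ^ 5) * G * (C * (l : ℝ) ^ (-(8 : ℝ))) := by
          gcongr
      _ = K * ((l : ℝ) ^ 5 * (l : ℝ) ^ (-(8 : ℝ))) := by
          rw [hK]; push_cast; ring
      _ = K * (l : ℝ) ^ (-(3 : ℝ)) := by
          rw [← Real.rpow_natCast, ← Real.rpow_add hl0]; norm_num

end Summability

/-! ### Helpers for (14.5): characters to the modulus `Dk` -/

section CharHelpers

/-- Membership in `finsetOf S` for a finite set `S`. [folklore] -/
private theorem mem_finsetOf_iff {α : Type*} {S : Set α} (hS : S.Finite) (x : α) :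
    x ∈ finsetOf S ↔ x ∈ S := by
  rw [finsetOf, dif_pos hS, Set.Finite.mem_toFinset]

/-- Splitting a sum over all characters `θ (mod N)` into `θ = ψ⁰`, `θ = θ₁` and the rest.
[cite: Zhang2022LandauSiegel, §14 u013–u015 p.78] -/
theorem sum_characters_split {N : ℕ} [NeZero N] (θ₁ : DirichletCharacter ℂ N) (h1 : θ₁ ≠ 1)
    (f : DirichletCharacter ℂ N → ℂ) :
    ∑ θ ∈ finsetOf (Set.univ : Set (DirichletCharacter ℂ N)), f θ =
      f 1 + f θ₁ + ∑ θ ∈ finsetOf {θ : DirichletCharacter ℂ N | θ ≠ 1 ∧ θ ≠ θ₁}, f θ := by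
  classical
  have hU : finsetOf (Set.univ : Set (DirichletCharacter ℂ N)) =
      insert 1 (insert θ₁ (finsetOf {θ : DirichletCharacter ℂ N | θ ≠ 1 ∧ θ ≠ θ₁})) := by
    ext θ
    simp only [mem_finsetOf_iff (Set.toFinite _), Set.mem_univ, Finset.mem_insert, Set.mem_setOf_eq,
      true_iff]
    tauto
  rw [hU, Finset.sum_insert, Finset.sum_insert, add_assoc]
  · simp only [mem_finsetOf_iff (Set.toFinite _), Set.mem_setOf_eq, ne_eq, not_true_eq_false,
      and_false, not_false_eq_true]
  · simp only [Finset.mem_insert, mem_finsetOf_iff (Set.toFinite _), Set.mem_setOf_eq, ne_eq,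
      not_true_eq_false, false_and, or_false]
    exact fun h => h1 h.symm

variable {D : ℕ} [NeZero D] (χ : DirichletCharacter ℂ D)

/-- `θ_k¹ ≠ ψ⁰_{Dk}`: the character induced by the primitive `χ (mod D)`, `D ≠ 1`, is not principal.
[cite: Zhang2022LandauSiegel, §14 u014 p.78] -/
theorem thetaOne_ne_one (hp : χ.IsPrimitive) (hD : D ≠ 1) {k : ℕ} (hk : k ≠ 0) :
    thetaOne χ k ≠ 1 := by
  haveI : NeZero (D * k) := ⟨mul_ne_zero (NeZero.ne D) hk⟩
  rw [thetaOne, Ne, DirichletCharacter.changeLevel_eq_one_iff]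
  exact GammaFactor.ne_one_of_isPrimitive hp hD

omit [NeZero D] in
/-- `θ_k¹` is real: `(θ_k¹)⁻¹ = θ_k¹` (`χ` quadratic). [cite: Zhang2022LandauSiegel, §14 u014 p.78] -/
theorem thetaOne_inv (hq : χ.IsQuadratic) (k : ℕ) : (thetaOne χ k)⁻¹ = thetaOne χ k := by
  rw [thetaOne, ← map_inv, hq.inv]

/-- A character `θ (mod N)` vanishes at `−l` when `(l, N) > 1` ("here we have removed the constraint
`(l,Dk) = 1` as it is superfluous", (14.7)). [cite: Zhang2022LandauSiegel, §14 (14.7) p.78] -/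
theorem apply_neg_natCast_eq_zero {N : ℕ} (θ : DirichletCharacter ℂ N) {l : ℕ}
    (h : ¬ Nat.Coprime l N) : θ (-(l : ZMod N)) = 0 := by
  apply MulChar.map_nonunit
  rw [IsUnit.neg_iff, ZMod.isUnit_iff_coprime]
  exact h

omit [NeZero D] in
/-- For the real `χ` and `p ∼ P` (`p ∤ D`): `χ(p)² = 1`. [cite: Zhang2022LandauSiegel, §14 (14.5) p.78] -/
theorem chi_sq_of_mem_primeWindow (hq : χ.IsQuadratic) (hD : 3 ≤ D) {p : ℕ}
    (hp : p ∈ primeWindow D) : χ (p : ZMod D) * χ (p : ZMod D) = 1 := by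
  have hprime : p.Prime := (Finset.mem_filter.mp hp).2
  have hlt := lt_of_mem_primeWindow hD hp
  have hcop : Nat.Coprime p D :=
    (Nat.Prime.coprime_iff_not_dvd hprime).mpr fun h => by
      have := Nat.le_of_dvd (by omega) h; omega
  have hu : IsUnit (p : ZMod D) := (ZMod.isUnit_iff_coprime p D).mpr hcop
  have hne : χ (p : ZMod D) ≠ 0 := (hu.map χ).ne_zero
  rcases hq (p : ZMod D) with h | h | h
  · exact absurd h hne
  · rw [h, one_mul]
  · rw [h]; norm_num

omit [NeZero D] χ in
/-- The window has at most `3P` members (`D ≥ 3`). [cite: Zhang2022LandauSiegel, §2 p.4] -/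
theorem card_primeWindow_le (hD : 3 ≤ D) : ((primeWindow D).card : ℝ) ≤ 3 * bigP D := by
  have h3 : (3 : ℝ) ≤ D := by exact_mod_cast hD
  have hlog : 1 ≤ Real.log D := by
    rw [← Real.log_exp 1]
    refine Real.log_le_log (Real.exp_pos 1) (le_trans ?_ h3)
    have := Real.exp_one_lt_d9; linarith
  have hP1 : 1 ≤ bigP D := by
    rw [bigP]; exact Real.one_le_exp (by positivity)
  have hℓ : (ell D ^ 68)⁻¹ ≤ 1 := by
    rw [ell]; exact inv_le_one_of_one_le₀ (one_le_pow₀ hlog)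
  have h1 : (primeWindow D).card ≤ ⌈bigP D * (1 + (ell D ^ 68)⁻¹)⌉₊ := by
    calc (primeWindow D).card ≤ (Finset.Ioo ⌊bigP D⌋₊ ⌈bigP D * (1 + (ell D ^ 68)⁻¹)⌉₊).card :=
          Finset.card_filter_le _ _
      _ = ⌈bigP D * (1 + (ell D ^ 68)⁻¹)⌉₊ - ⌊bigP D⌋₊ - 1 := Nat.card_Ioo _ _
      _ ≤ ⌈bigP D * (1 + (ell D ^ 68)⁻¹)⌉₊ := by omega
  have h2 : (⌈bigP D * (1 + (ell D ^ 68)⁻¹)⌉₊ : ℝ) < bigP D * (1 + (ell D ^ 68)⁻¹) + 1 :=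
    Nat.ceil_lt_add_one (by positivity)
  calc ((primeWindow D).card : ℝ) ≤ ⌈bigP D * (1 + (ell D ^ 68)⁻¹)⌉₊ := by exact_mod_cast h1
    _ ≤ bigP D * (1 + (ell D ^ 68)⁻¹) + 1 := h2.le
    _ ≤ bigP D * (1 + 1) + bigP D := by gcongr
    _ = 3 * bigP D := by ring

omit [NeZero D] χ in
/-- `major1413 ≥ 0`. [cite: Zhang2022LandauSiegel, §14 u013 p.78] -/
theorem major1413_nonneg (p : ℕ) (κs as : ℕ → ℂ) : 0 ≤ major1413 D p κs as := by
  unfold major1413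
  refine Finset.sum_nonneg fun d _ => mul_nonneg (by positivity) (Finset.sum_nonneg fun k _ => ?_)
  exact tsum_nonneg fun l => by positivity

/-- `(log D)^c ≤ D^{1/4}` for large `D` (the `𝓛ᶜ` of u013 is absorbed in the `D^{1/2−c}` of (14.5)).
[cite: Zhang2022LandauSiegel, §14 (14.5) p.78] -/
theorem eventually_log_rpow_le_rpow_quarter (c : ℝ) :
    ∃ D₁ : ℕ, ∀ D : ℕ, D₁ ≤ D → Real.log D ^ c ≤ (D : ℝ) ^ (1 / 4 : ℝ) := by
  have h := (isLittleO_log_rpow_rpow_atTop c (show (0 : ℝ) < 1 / 4 by norm_num)).bound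
    (show (0 : ℝ) < 1 by norm_num)
  have h2 : ∀ᶠ D : ℕ in atTop, ‖Real.log (D : ℝ) ^ c‖ ≤ 1 * ‖(D : ℝ) ^ (1 / 4 : ℝ)‖ :=
    tendsto_natCast_atTop_atTop.eventually h
  obtain ⟨D₁, hD₁⟩ := Filter.eventually_atTop.mp h2
  refine ⟨D₁, fun D hD => ?_⟩
  have h3 := hD₁ D hD
  rw [one_mul, Real.norm_eq_abs, Real.norm_eq_abs,
    abs_of_nonneg (Real.rpow_nonneg (Nat.cast_nonneg D) _)] at h3
  exact (le_abs_self _).trans h3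

end CharHelpers


end Literature.NumberTheory.LFunctions.Zhang2022.Typed.Sec14
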